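/-
Copyright (c) 2026 the pub-hodgecm-mathlib formalisation cell (harness21).  Prover seat hodgecm-mathlib-K2Liu-p01 (g2): Track B «K2-LIT»,
#184♮ = hLiu418 = stmt-HodgeConjecture-24832, STEWARD of socket #41; organ O41.5 (Gindikin–Karpelevich), ROADMAP
`K2/K2Liu-p01/g2/ROADMAP-O41_5-GindikinKarpelevich.K2Liup01g2.md` a6873eb1b770b760, sub-organ O41.5c (topological half) at rank one.
-/
import Summits.HodgeConjecture.HodgeConjecture.Theorems.K2LiuGKRankOneValue   -- ★ rank-one coordinates, profile, GK value
import HarnessLib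

/-!
# Crux `HLiu418`, road `K2_Liu`, socket #41, organ O41.5c∕d at RANK ONE: HAAR TRANSPORT along `b ↦ n(ι_v b · δ)` and the
# `N_Δ`-form of the rank-one Gindikin–Karpelevich identity `∫_{N_Δ(F_v)} φ°(w_Δ u) dν_N(u) = ν_N(N_Δ ∩ K_v) · (1 − t)/(1 − q_v t)`

Cell `hodgecm-mathlib`, crux item hLiu418 = `stmt-HodgeConjecture-24832`; squad K2 ∕ K2Liu; prover K2Liu-p01 (g2), steward of #41.
THEOREMS ONLY (no `def`, no instance, no notation, no named-fact hypothesis, no `sorry`); lane `--supports stmt-HodgeConjecture-24832`.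

* §1 continuity: `matS`, `matA`, `u ↦ B(u)` are continuous on `H(F_v)`; the inverse coordinate `ψ : u ↦ im(B(u)₀₀)` is continuous on `N_Δ(F_v)`;
  the coordinate `b ↦ n(ι_v b · δ)` is continuous `F_v → N_Δ(F_v)` (`Units.continuous_iff`: matrix and inverse matrix are affine in `b`).
* §2 `exists_homeomorph_coord`: **`F_v ≃ₜ N_Δ(F_v)`**, `b ↦ n(ι_v b · δ)`, inverse `ψ`, additive-to-multiplicative.
* §3 HAAR TRANSPORT: for a Haar measure `ν_N` on `N_Δ(F_v)`, **`ν_N ∘ ψ⁻¹` is an additive Haar measure on `F_v`** (`isAddHaarMeasure_map_coordInv`),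
  `∫ f(u) dν_N = ∫ f(n(ι_v b δ)) d(ν_N ∘ ψ⁻¹)(b)` (`integral_comp_coord`), and `(ν_N ∘ ψ⁻¹)(𝒪_v) = ν_N(N_Δ ∩ K_v)` (`map_coordInv_primePowBall_zero`).
* §4 **THE `N_Δ`-FORM** `localIntertwining_one_eq`: `(M_v(s)φ°)(1) = ∫_{N_Δ(F_v)} φ°(w_Δ u) dν_N(u) = ν_N(N_Δ ∩ K_v) · (1 − t)/(1 − q_v t)`,
  `t = (∏_{w∣v} χ_w(ι_w ϖ)) · (∏_{w∣v} ‖ι_w ϖ‖_w)^{s+1/2}` (★ `K2LiuGKRankOneValue.integral_apply_weylDelta_nElem_coord` on the transported measure).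
[HarrisKudlaSweet1996, §6 (6.14)–(6.16)] [Casselman1980, §3 Thm. 3.1] [Kudla1994, §3] [Weil1965, §37 (Haar transport)].
HONEST LABEL.  Count-neutral helper; it retires nothing by itself: `HC_CM` is proved only modulo the 7 printed citations (2 remaining named inputs:
hLiu418 = `stmt-HodgeConjecture-24832`, h413 = `stmt-HodgeConjecture-24833`) until rung 0 closes.

## References
* [HarrisKudlaSweet1996] M. Harris, S. Kudla, W. J. Sweet, J. AMS 9 (1996): §6 (6.14)–(6.16).
* [Casselman1980] W. Casselman, Compositio Math. 40 (1980): §3.   * [Kudla1994] S. S. Kudla, Israel J. Math. 87 (1994): §3.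
* [Weil1965] A. Weil, *L'intégration dans les groupes topologiques* (2nd ed. 1965): §37.
-/

set_option autoImplicit false
set_option linter.dupNamespace false -- the mandated namespace repeats `HodgeConjecture.HodgeConjecture`

noncomputable section

open NumberField IsDedekindDomain Matrix MeasureTheory Topology
open scoped ValuativeRel NNReal
open Literature.NumberTheory.GaloisRepresentations.IsNonarchimedeanLocalField
open Literature.NumberTheory.Automorphic Literature.NumberTheory.Automorphic.UnitaryGroup
open Literature.NumberTheory.GelbartRogawski1991.AdaptedBlocks
open Literature.NumberTheory.GelbartRogawski1991.UnitaryDualPair.LocalSplitting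
open Literature.NumberTheory.K2Lit.LocalSiegelDoubled
open Summit.HodgeConjecture.HodgeConjecture.Cruxes.HLiu418.K2LiuUnipDeltaLocalCoordinates
open Summit.HodgeConjecture.HodgeConjecture.Cruxes.HLiu418.K2LiuUnipDeltaRankOneCoordinates
open Summit.HodgeConjecture.HodgeConjecture.Cruxes.HLiu418.K2LiuGKRankOneValue

namespace Summit.HodgeConjecture.HodgeConjecture.Cruxes.HLiu418.K2LiuUnipDeltaRankOneHaar

variable (F : Type) [Field F] [NumberField F] (E : Type) [Field E] [NumberField E] [Algebra F E]
  [Algebra.IsQuadraticExtension F E] (c : E ≃ₐ[F] E) {δ : E} (hcδ : c δ = -δ) (hδ : δ ≠ 0) {d : F} (hd : δ * δ = algebraMap F E d)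
  (v : HeightOneSpectrum (𝓞 F))

/-! ## §1 Continuity -/

section General

variable (n : ℕ) {T₀ : Matrix (Fin n) (Fin n) F} {JD : Matrix (Fin (n + n)) (Fin (n + n)) E}

omit [Algebra.IsQuadraticExtension F E] in
/-- `g ↦ matS g` (the matrix of `g ∈ H(F_v)` over `E ⊗ F_v`) is continuous. [cite: MoeglinVignerasWaldspurger1987, Chap. 2 II.8] -/
theorem continuous_matS : Continuous (matS F E c v n (JD := JD)) :=
  Units.continuous_val.comp (continuous_subtype_val.comp (localPiEquiv E c (n + n) JD v).continuous)

omit [Algebra.IsQuadraticExtension F E] in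
/-- `g ↦ matA g` (the adapted re-enumeration) is continuous. [cite: MoeglinVignerasWaldspurger1987, Chap. 2 II.8] -/
theorem continuous_matA : Continuous (matA F E c v n (JD := JD)) :=
  (continuous_matS F E c v n).matrix_reindex _ _

omit [Algebra.IsQuadraticExtension F E] in
/-- `g ↦ B(g)` (the adapted `Δ⁻ → Δ` corner) is continuous. [cite: Kudla1994, §3] -/
theorem continuous_blkB_matA : Continuous fun g : UnitaryGroup.localPi E c (n + n) JD v => blkB (matA F E c v n g) := by
  have h : (fun g : UnitaryGroup.localPi E c (n + n) JD v => blkB (matA F E c v n g)) =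
      fun g => (cayRinv (LocalRing E v) (Fin n) * matA F E c v n g * cayR (LocalRing E v) (Fin n)).submatrix Sum.inl Sum.inr := by
    funext g
    have h1 := adapt_eq (matA F E c v n g)
    rw [adapt] at h1
    rw [h1]
    ext i j
    rw [Matrix.submatrix_apply, Matrix.fromBlocks_apply₁₂]
  rw [h]
  exact ((continuous_const.matrix_mul (continuous_matA F E c v n)).matrix_mul continuous_const).matrix_submatrix _ _

end General

/-! ## §2 Rank one: the coordinate `b ↦ n(ι_v b · δ)` is a homeomorphism `F_v ≃ₜ N_Δ(F_v)` -/

section RankOne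

variable {T₀ : Matrix (Fin 1) (Fin 1) F} (hT₀d : IsUnit T₀.det)
  {JD : Matrix (Fin (1 + 1)) (Fin (1 + 1)) E} (hJD : JD = (gramD F 1 T₀).map (algebraMap F E))

include hcδ hδ in
/-- the inverse coordinate `ψ : u ↦ im(B(u)₀₀)` is continuous on `N_Δ(F_v)`. [cite: Weil1965, §37] -/
theorem continuous_coordInv :
    Continuous fun u : unipDeltaLocal F E c v 1 (JD := JD) =>
      ((quadraticLocalEquiv E v c hcδ hδ).symm (blkB (matA F E c v 1 (u : UnitaryGroup.localPi E c (1 + 1) JD v)) 0 0)).2 :=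
  continuous_snd.comp ((quadraticLocalEquiv E v c hcδ hδ).symm.continuous.comp
    (((continuous_blkB_matA F E c v 1).comp continuous_subtype_val).matrix_elem 0 0))

omit [Algebra.IsQuadraticExtension F E] in
/-- the matrix of `n(t)` is `reindex (R (1 t; 0 1) R⁻¹)`. [cite: Kudla1994, §3] -/
theorem matS_nElem {t : Matrix (Fin 1) (Fin 1) (LocalRing E v)}
    (ht : (t.map (conjLocal E c v))ᵀ * gramS F E v 1 T₀ + gramS F E v 1 T₀ * t = 0) :
    matS F E c v 1 (nElem F E c v 1 hJD t ht) =
      Matrix.reindex (e₂ 1) (e₂ 1) (cayR (LocalRing E v) (Fin 1) * Matrix.fromBlocks 1 t 0 1 * cayRinv (LocalRing E v) (Fin 1)) := by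
  rw [← reindex_matA]
  unfold nElem
  rw [matA_ofAdapted]

omit [Algebra.IsQuadraticExtension F E] in
/-- `b ↦ reindex (R (1 (±ι b δ); 0 1) R⁻¹)` is continuous. [cite: Weil1965, §37] -/
theorem continuous_reindex_unip (ε : LocalRing E v) :
    Continuous fun b : v.adicCompletion F => Matrix.reindex (e₂ 1) (e₂ 1)
      (cayR (LocalRing E v) (Fin 1) * Matrix.fromBlocks 1 (Matrix.of fun _ _ : Fin 1 => toLocalRing E v b * ε) 0 1 * cayRinv (LocalRing E v) (Fin 1)) :=
  ((continuous_const.matrix_mul (Continuous.matrix_fromBlocks continuous_const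
    (continuous_matrix fun _ _ => (continuous_toLocalRing E v).mul continuous_const) continuous_const continuous_const)).matrix_mul
      continuous_const).matrix_reindex _ _

omit [Algebra.IsQuadraticExtension F E] in
include hcδ hT₀d hJD in
/-- **the coordinate `b ↦ n(ι_v b · δ)` is continuous `F_v → N_Δ(F_v)`** (matrix and inverse matrix are affine in `b`). [cite: Weil1965, §37] -/
theorem continuous_nElem_coord :
    Continuous fun b : v.adicCompletion F =>
      (⟨nElem F E c v 1 hJD (Matrix.of fun _ _ : Fin 1 => toLocalRing E v b * algebraMap E (LocalRing E v) δ) (skew_coord F E c hcδ v hT₀d b),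
        nElem_coord_mem_unipDeltaLocal F E c hcδ v hT₀d hJD b⟩ : unipDeltaLocal F E c v 1 (JD := JD)) := by
  refine Continuous.subtype_mk ?_ _
  refine continuous_induced_rng.2 ?_
  change Continuous fun b : v.adicCompletion F => ((nElem F E c v 1 hJD (Matrix.of fun _ _ : Fin 1 => toLocalRing E v b * algebraMap E (LocalRing E v) δ)
      (skew_coord F E c hcδ v hT₀d b) : UnitaryGroup.localPi E c (1 + 1) JD v) : UnitaryGroup.LocalGLPi E (1 + 1) v)
  have hcoe : (fun b : v.adicCompletion F => ((nElem F E c v 1 hJD (Matrix.of fun _ _ : Fin 1 => toLocalRing E v b * algebraMap E (LocalRing E v) δ)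
      (skew_coord F E c hcδ v hT₀d b) : UnitaryGroup.localPi E c (1 + 1) JD v) : UnitaryGroup.LocalGLPi E (1 + 1) v)) =
      fun b => localGLPiEquiv E (1 + 1) v ((localPiEquiv E c (1 + 1) JD v (nElem F E c v 1 hJD
        (Matrix.of fun _ _ : Fin 1 => toLocalRing E v b * algebraMap E (LocalRing E v) δ) (skew_coord F E c hcδ v hT₀d b))).1) :=
    funext fun b => ((localGLPiEquiv E (1 + 1) v).apply_symm_apply _).symm
  rw [hcoe]
  refine (localGLPiEquiv E (1 + 1) v).continuous.comp (Units.continuous_iff.2 ⟨?_, ?_⟩)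
  · show Continuous fun b => matS F E c v 1 (nElem F E c v 1 hJD (Matrix.of fun _ _ : Fin 1 => toLocalRing E v b * algebraMap E (LocalRing E v) δ)
      (skew_coord F E c hcδ v hT₀d b))
    simp only [matS_nElem]
    exact continuous_reindex_unip F E v _
  · have h : (fun b : v.adicCompletion F => Units.val ((localPiEquiv E c (1 + 1) JD v (nElem F E c v 1 hJD
        (Matrix.of fun _ _ : Fin 1 => toLocalRing E v b * algebraMap E (LocalRing E v) δ) (skew_coord F E c hcδ v hT₀d b))).1⁻¹)) =
        fun b => Matrix.reindex (e₂ 1) (e₂ 1) (cayR (LocalRing E v) (Fin 1) *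
          Matrix.fromBlocks 1 (Matrix.of fun _ _ : Fin 1 => toLocalRing E v b * -algebraMap E (LocalRing E v) δ) 0 1 * cayRinv (LocalRing E v) (Fin 1)) := by
      funext b
      rw [← Subgroup.coe_inv, ← map_inv, nElem_inv]
      show matS F E c v 1 _ = _
      rw [matS_nElem]
      have hneg : -(Matrix.of fun _ _ : Fin 1 => toLocalRing E v b * algebraMap E (LocalRing E v) δ) =
          Matrix.of fun _ _ : Fin 1 => toLocalRing E v b * -algebraMap E (LocalRing E v) δ := by
        ext i j
        rw [Matrix.neg_apply, Matrix.of_apply, Matrix.of_apply, mul_neg]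
      rw [hneg]
    rw [h]
    exact continuous_reindex_unip F E v _

include hcδ hδ hT₀d hJD in
/-- **`F_v ≃ₜ N_Δ(F_v)`, `b ↦ n(ι_v b · δ)`, with inverse `u ↦ im(B(u)₀₀)`.** [cite: HarrisKudlaSweet1996, §1 (1.11)–(1.12)] [cite: Weil1965, §37] -/
theorem exists_homeomorph_coord :
    ∃ e : v.adicCompletion F ≃ₜ unipDeltaLocal F E c v 1 (JD := JD),
      (∀ b, e b = ⟨nElem F E c v 1 hJD (Matrix.of fun _ _ : Fin 1 => toLocalRing E v b * algebraMap E (LocalRing E v) δ) (skew_coord F E c hcδ v hT₀d b),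
        nElem_coord_mem_unipDeltaLocal F E c hcδ v hT₀d hJD b⟩) ∧
      (∀ u, e.symm u = ((quadraticLocalEquiv E v c hcδ hδ).symm (blkB (matA F E c v 1 (u : UnitaryGroup.localPi E c (1 + 1) JD v)) 0 0)).2) := by
  have hΨ : ∀ b : v.adicCompletion F, quadraticLocalEquiv E v c hcδ hδ (0, b) = toLocalRing E v b * algebraMap E (LocalRing E v) δ := fun b => by
    rw [quadraticLocalEquiv_apply, map_zero, zero_add]
  have hleft : ∀ b : v.adicCompletion F, ((quadraticLocalEquiv E v c hcδ hδ).symm (blkB (matA F E c v 1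
      (nElem F E c v 1 hJD (Matrix.of fun _ _ : Fin 1 => toLocalRing E v b * algebraMap E (LocalRing E v) δ) (skew_coord F E c hcδ v hT₀d b))) 0 0)).2 = b :=
    fun b => by rw [blkB_matA_nElem, Matrix.of_apply, ← hΨ, ContinuousLinearEquiv.symm_apply_apply]
  refine ⟨⟨⟨fun b => ⟨_, nElem_coord_mem_unipDeltaLocal F E c hcδ v hT₀d hJD b⟩,
    fun u => ((quadraticLocalEquiv E v c hcδ hδ).symm (blkB (matA F E c v 1 (u : UnitaryGroup.localPi E c (1 + 1) JD v)) 0 0)).2,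
    hleft, fun u => ?_⟩, continuous_nElem_coord F E c hcδ v hT₀d hJD, continuous_coordInv F E c hcδ hδ v⟩, fun b => rfl, fun u => rfl⟩
  obtain ⟨b₀, hb₀, -⟩ := existsUnique_eq_nElem_coord F E c hcδ hδ v hT₀d hJD u.2
  have hψ : ((quadraticLocalEquiv E v c hcδ hδ).symm (blkB (matA F E c v 1 (u : UnitaryGroup.localPi E c (1 + 1) JD v)) 0 0)).2 = b₀ := by
    rw [hb₀]; exact hleft b₀
  have key : ∀ {b b' : v.adicCompletion F}, b = b' →
      nElem F E c v 1 hJD (Matrix.of fun _ _ : Fin 1 => toLocalRing E v b * algebraMap E (LocalRing E v) δ) (skew_coord F E c hcδ v hT₀d b) =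
        nElem F E c v 1 hJD (Matrix.of fun _ _ : Fin 1 => toLocalRing E v b' * algebraMap E (LocalRing E v) δ) (skew_coord F E c hcδ v hT₀d b') :=
    fun h => h ▸ rfl
  exact Subtype.ext ((key hψ).trans hb₀.symm)

/-! ## §3 Haar transport along the coordinate -/

variable [MeasurableSpace (v.adicCompletion F)] [BorelSpace (v.adicCompletion F)]
  [MeasurableSpace (unipDeltaLocal F E c v 1 (JD := JD))] [BorelSpace (unipDeltaLocal F E c v 1 (JD := JD))]

include hcδ hδ hT₀d hJD in
/-- **HAAR TRANSPORT**: for a Haar measure `ν_N` on `N_Δ(F_v)`, its push-forward `ν_N ∘ ψ⁻¹` along the inverse coordinate `ψ : u ↦ im(B(u)₀₀)`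
is an ADDITIVE HAAR MEASURE on `F_v` (the coordinate is a homeomorphism and turns `+` into `·`). [cite: Weil1965, §37] [cite: Casselman1980, §3] -/
theorem isAddHaarMeasure_map_coordInv (νN : Measure (unipDeltaLocal F E c v 1 (JD := JD))) [νN.IsHaarMeasure] :
    (Measure.map (fun u : unipDeltaLocal F E c v 1 (JD := JD) =>
      ((quadraticLocalEquiv E v c hcδ hδ).symm (blkB (matA F E c v 1 (u : UnitaryGroup.localPi E c (1 + 1) JD v)) 0 0)).2) νN).IsAddHaarMeasure := by
  obtain ⟨e, he, hes⟩ := exists_homeomorph_coord F E c hcδ hδ v hT₀d hJD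
  rw [show (fun u : unipDeltaLocal F E c v 1 (JD := JD) =>
      ((quadraticLocalEquiv E v c hcδ hδ).symm (blkB (matA F E c v 1 (u : UnitaryGroup.localPi E c (1 + 1) JD v)) 0 0)).2) = ⇑e.symm
    from funext fun u => (hes u).symm]
  have hmul : ∀ b b' : v.adicCompletion F, e (b + b') = e b * e b' := fun b b' => by
    rw [he, he, he]
    exact Subtype.ext (nElem_coord_add F E c hcδ v hT₀d hJD b b')
  haveI : IsFiniteMeasureOnCompacts (Measure.map e.symm νN) := ⟨fun K hK => by
    rw [Measure.map_apply e.symm.measurable hK.measurableSet, ← e.image_eq_preimage_symm]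
    exact (hK.image e.continuous).measure_lt_top⟩
  haveI : (Measure.map e.symm νN).IsOpenPosMeasure := ⟨fun U hU hne => by
    rw [Measure.map_apply e.symm.measurable hU.measurableSet, ← e.image_eq_preimage_symm]
    exact (e.isOpenMap U hU).measure_ne_zero νN (hne.image e)⟩
  haveI : (Measure.map e.symm νN).IsAddLeftInvariant := ⟨fun b => by
    have hadd : Continuous fun x : v.adicCompletion F => b + x := continuous_const.add continuous_id
    have hmulc : Continuous fun u : unipDeltaLocal F E c v 1 (JD := JD) => e b * u := continuous_const.mul continuous_id
    rw [Measure.map_map hadd.measurable e.symm.measurable]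
    have hcomp : ((fun x => b + x) ∘ e.symm) = (e.symm ∘ fun u => e b * u) := by
      funext u
      simp only [Function.comp_apply]
      apply e.injective
      rw [hmul, e.apply_symm_apply, e.apply_symm_apply]
    rw [hcomp, ← Measure.map_map e.symm.measurable hmulc.measurable, map_mul_left_eq_self νN (e b)]⟩
  exact { toIsFiniteMeasureOnCompacts := inferInstance, toIsAddLeftInvariant := inferInstance, toIsOpenPosMeasure := inferInstance }

include hcδ hδ hT₀d hJD in
/-- **change of variables**: `∫_{N_Δ(F_v)} f(u) dν_N(u) = ∫_{F_v} f(n(ι_v b · δ)) d(ν_N ∘ ψ⁻¹)(b)` for ANY `f` (no integrability needed: a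
measurable equivalence). [cite: Weil1965, §37] -/
theorem integral_comp_coord (νN : Measure (unipDeltaLocal F E c v 1 (JD := JD))) (f : UnitaryGroup.localPi E c (1 + 1) JD v → ℂ) :
    ∫ u, f (u : UnitaryGroup.localPi E c (1 + 1) JD v) ∂νN =
      ∫ b, f (nElem F E c v 1 hJD (Matrix.of fun _ _ : Fin 1 => toLocalRing E v b * algebraMap E (LocalRing E v) δ) (skew_coord F E c hcδ v hT₀d b))
        ∂(Measure.map (fun u : unipDeltaLocal F E c v 1 (JD := JD) =>
          ((quadraticLocalEquiv E v c hcδ hδ).symm (blkB (matA F E c v 1 (u : UnitaryGroup.localPi E c (1 + 1) JD v)) 0 0)).2) νN) := by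
  obtain ⟨e, he, hes⟩ := exists_homeomorph_coord F E c hcδ hδ v hT₀d hJD
  rw [show (fun u : unipDeltaLocal F E c v 1 (JD := JD) =>
      ((quadraticLocalEquiv E v c hcδ hδ).symm (blkB (matA F E c v 1 (u : UnitaryGroup.localPi E c (1 + 1) JD v)) 0 0)).2) = ⇑e.symm
    from funext fun u => (hes u).symm, ← Homeomorph.toMeasurableEquiv_coe, integral_map_equiv]
  refine integral_congr_ae (Filter.Eventually.of_forall fun u => ?_)
  have h1 : nElem F E c v 1 hJD (Matrix.of fun _ _ : Fin 1 => toLocalRing E v (e.symm u) * algebraMap E (LocalRing E v) δ)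
      (skew_coord F E c hcδ v hT₀d (e.symm u)) = (u : UnitaryGroup.localPi E c (1 + 1) JD v) := by
    have h := congrArg Subtype.val (he (e.symm u))
    rw [e.apply_symm_apply] at h
    exact h.symm
  simp only [Homeomorph.toMeasurableEquiv_coe]
  rw [h1]

include hcδ hδ hT₀d hJD in
/-- **`(ν_N ∘ ψ⁻¹)(𝒪_v) = ν_N(N_Δ(F_v) ∩ K_v)`** at a place with `|2|_w = |δ|_w = 1` (★ `nElem_coord_mem_localInt_iff`): the normalising volume.
[cite: Casselman1980, §3] [cite: HarrisKudlaSweet1996, §6 (6.14)] -/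
theorem map_coordInv_primePowBall_zero (νN : Measure (unipDeltaLocal F E c v 1 (JD := JD)))
    (h2 : ∀ w : PlacesOver E v, ValuativeRel.valuation (w.1.adicCompletion E) (2 : w.1.adicCompletion E) = 1)
    (hδw : ∀ w : PlacesOver E v, Valued.v ((δ : E) : w.1.adicCompletion E) = 1) :
    (Measure.map (fun u : unipDeltaLocal F E c v 1 (JD := JD) =>
        ((quadraticLocalEquiv E v c hcδ hδ).symm (blkB (matA F E c v 1 (u : UnitaryGroup.localPi E c (1 + 1) JD v)) 0 0)).2) νN)
        (primePowBall (v.adicCompletion F) 0) =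
      νN {u | (u : UnitaryGroup.localPi E c (1 + 1) JD v) ∈ UnitaryGroup.localInt E c (1 + 1) JD v} := by
  obtain ⟨e, he, hes⟩ := exists_homeomorph_coord F E c hcδ hδ v hT₀d hJD
  rw [show (fun u : unipDeltaLocal F E c v 1 (JD := JD) =>
      ((quadraticLocalEquiv E v c hcδ hδ).symm (blkB (matA F E c v 1 (u : UnitaryGroup.localPi E c (1 + 1) JD v)) 0 0)).2) = ⇑e.symm
    from funext fun u => (hes u).symm, Measure.map_apply e.symm.measurable (measurableSet_primePowBall 0)]
  congr 1
  ext u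
  have h1 : nElem F E c v 1 hJD (Matrix.of fun _ _ : Fin 1 => toLocalRing E v (e.symm u) * algebraMap E (LocalRing E v) δ)
      (skew_coord F E c hcδ v hT₀d (e.symm u)) = (u : UnitaryGroup.localPi E c (1 + 1) JD v) := by
    have h := congrArg Subtype.val (he (e.symm u))
    rw [e.apply_symm_apply] at h
    exact h.symm
  rw [Set.mem_preimage, mem_primePowBall_zero_iff_valued F v, Set.mem_setOf_eq, ← nElem_coord_mem_localInt_iff F E c hcδ v hT₀d hJD h2 hδw (e.symm u),
    h1]

/-! ## §4 The `N_Δ`-form of the rank-one Gindikin–Karpelevich identity -/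

include hδ hT₀d in
/-- **THE RANK-ONE GINDIKIN–KARPELEVICH IDENTITY IN `N_Δ`-FORM** (`H(F_v) ≅ U(1,1)(F_v)`): for a spherical section `φ°` of `I_v(s, χ_v)` (★ D10),
a Haar measure `ν_N` on `N_Δ(F_v)`, `|2|_w = |δ|_w = 1` and `χ_w` unramified at every `w ∣ v`, a uniformizer `ϖ` of `F_v`, and
`t := (∏_{w∣v} χ_w(ι_w ϖ)) · (∏_{w∣v} ‖ι_w ϖ‖_w)^{s+1/2}` with `‖t‖ < q_v⁻¹`:
**`(M_v(s)φ°)(1) = ∫_{N_Δ(F_v)} φ°(w_Δ u) dν_N(u) = ν_N(N_Δ(F_v) ∩ K_v) · (1 − t)/(1 − q_v t)`**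
(★ D10 `localIntertwining`; ★ `integral_apply_weylDelta_nElem_coord` on the transported measure `ν_N ∘ ψ⁻¹`, §3).
[cite: HarrisKudlaSweet1996, §6 (6.14)–(6.16)] [cite: Casselman1980, §3 Thm. 3.1] [cite: Kudla1994, §3] -/
theorem localIntertwining_one_eq (hT₀ : T₀.IsSymm) (νN : Measure (unipDeltaLocal F E c v 1 (JD := JD))) [νN.IsHaarMeasure]
    (χv : ∀ w : PlacesOver E v, (w.1.adicCompletion E)ˣ →* ℂˣ) (s : ℂ)
    {φ : UnitaryGroup.localPi E c (1 + 1) JD v → ℂ} (hφ : IsSphericalSection F E c hcδ hδ hd v 1 hT₀ hJD χv s φ)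
    (h2 : ∀ w : PlacesOver E v, ValuativeRel.valuation (w.1.adicCompletion E) (2 : w.1.adicCompletion E) = 1)
    (hδw : ∀ w : PlacesOver E v, Valued.v ((δ : E) : w.1.adicCompletion E) = 1)
    (hχ : ∀ (w : PlacesOver E v) (u : (w.1.adicCompletion E)ˣ), Valued.v (u : w.1.adicCompletion E) = 1 → χv w u = 1)
    {ϖ : v.adicCompletion F} (hϖ : Valued.v ϖ = WithZero.exp (-1 : ℤ)) (hϖ0 : ∀ w : PlacesOver E v, toPlace v w ϖ ≠ 0)
    (ht : ‖(((∏ w : PlacesOver E v, χv w (Units.mk0 (toPlace v w ϖ) (hϖ0 w))) : ℂˣ) : ℂ) *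
          (((∏ w : PlacesOver E v, ‖toPlace v w ϖ‖) : ℝ) : ℂ) ^ (s + 1 / 2)‖ < (residueFieldCard (v.adicCompletion F) : ℝ)⁻¹) :
    localIntertwining F E c v 1 hJD νN φ 1 =
      νN.real {u | (u : UnitaryGroup.localPi E c (1 + 1) JD v) ∈ UnitaryGroup.localInt E c (1 + 1) JD v} *
        ((1 - ((((∏ w : PlacesOver E v, χv w (Units.mk0 (toPlace v w ϖ) (hϖ0 w))) : ℂˣ) : ℂ) *
                (((∏ w : PlacesOver E v, ‖toPlace v w ϖ‖) : ℝ) : ℂ) ^ (s + 1 / 2))) /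
          (1 - (residueFieldCard (v.adicCompletion F) : ℂ) *
            ((((∏ w : PlacesOver E v, χv w (Units.mk0 (toPlace v w ϖ) (hϖ0 w))) : ℂˣ) : ℂ) *
                (((∏ w : PlacesOver E v, ‖toPlace v w ϖ‖) : ℝ) : ℂ) ^ (s + 1 / 2)))) := by
  unfold localIntertwining
  simp only [mul_one]
  rw [integral_comp_coord F E c hcδ hδ v hT₀d hJD νN (fun g => φ (weylDelta F E c v 1 hJD * g))]
  haveI := isAddHaarMeasure_map_coordInv F E c hcδ hδ v hT₀d hJD νN
  rw [(integral_apply_weylDelta_nElem_coord F E c hcδ hδ hd v hT₀ hT₀d hJD _ χv s hφ h2 hδw hχ hϖ hϖ0 ht).2, measureReal_def,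
    map_coordInv_primePowBall_zero F E c hcδ hδ v hT₀d hJD νN h2 hδw, ← measureReal_def]

end RankOne

end Summit.HodgeConjecture.HodgeConjecture.Cruxes.HLiu418.K2LiuUnipDeltaRankOneHaar

end
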